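import Summits.HodgeConjecture.HodgeConjecture.Theorems.F0P3cStCharTSDeltaCosetConst          -- ★ p849690 (LH6-p03 g0) `exists_level_forall_finTau_eq_and_finWeylRatio_eq`, §1 box algebra `map_sub_one_lt_of_mul_eq_one`, `exp_neg_succ_le_one`
import Summits.HodgeConjecture.HodgeConjecture.Theorems.F0P3cStCharTSOnStratumG              -- ★ p849509 `lt_one_lt_of_mul_eq_one_of_lt` (folklore valuation bookkeeping)
import Literature.NumberTheory.Rogawski1990.FinExplicitTransferFactorInertPlaceValuation     -- ★ `valued_finGammaTwo_apply_eq_one` (`|u|_w = 1`)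
import Summits.HodgeConjecture.HodgeConjecture.Theorems.F0P3cStCharTSLevelPick                -- ★ p849741 LEVEL-PICK «BOX-OPEN» `isOpen_levelBox`, `one_mem_levelBox`
import HarnessLib

/-!
# F0 · P3c · line LH6 «StCharTS» — road (D) «DEEP-FL», (D-c) brick ⑥ «HTAU-ON-COSET★»: `τ_v` is constant on each refined coset `u_j · S′` of the oriented hyperbolic Levi
# shell — the `hτ` clause of ★ KIT-B `F0P3cStCharTSHleviCosets.hc_of_cosetSum` ∕ `hc_of_cosets`

Cell `pub/hodgecm-mathlib`, crux H413 = `stmt-HodgeConjecture-24833` (lane `--supports … --as helper`), route HCCMUnconditional; seat LH6-p03 (g2) (lineage heir of the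
road-(D) owner LH6-p03 (g0)); dealt BY NAME by the road (D) owner of record LH6-p04 (g3) 2026-09-02T06:27:56Z, ROAD-D status v7 `F0/P3b/LH6-p04/g3/ROAD-D.status.v7.txt`
(7d68ee6667d2d4d5) line «hτ ⇐ ⑥ HTAU-ON-COSET★ (LH6-p03 (g2)) over ★ p849690∕p849645 + ★ LEVEL-PICK (S′ ⊆ μ-box)».  THEOREMS ONLY, sorry-free, ★-only imports; no definition ∕
instance ∕ notation ∕ named fact.  HONEST LABEL: HC_CM is proved only modulo the 7 printed citations (2 remaining: hLiu418 = stmt-HodgeConjecture-24832, h413 =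
stmt-HodgeConjecture-24833) until rung 0 closes; count-neutral plumbing of road (D) — closes nothing by itself.

THE MATHEMATICS ([Rogawski1990, §4.9 p. 55: `τ(γ_H) = μ(γ₂)·μ((γ₂γ₁⁻¹ − 1)(1 − γ₂γ₃⁻¹))⁻¹`; Prop. 8.1.3 (proof) p. 116 «for `t` sufficiently close to `1`»; §12.7 L. 12.7.3
(proof) p. 195]).  ROAD-D v5 CHANGE 1 refines the `H`-side test function along cosets `C_j = u_j · S′` of a level subgroup `S′ ≤ T_H × U(Φ₁)_v` whose torus coordinates lie in
the principal congruence box of level `n_μ ≥ cond(μ_v)` (★ `F0P3cStCharTSMuTrivial`, ★ LEVEL-PICK).  KIT-B's checklist then asks (`hτ`): along the hyperbolic `G`-regular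
diagonal-Levi stratum (`γ_H = (diag(d′₀, d′₁), u)`, `|d′₁|_w < |d′₀|_w`, `σ_w(d′₀,w)·d′₁,w = 1`), `finTau L v γ_H μ = τ_j := finTau L v u_j μ` whenever `(t_H, u) ∈ C_j`.  PROOF: write
`γ_H = u_j · k` with `k ∈ S′`; the diagonal frame of `u_j` is `d′ · e⁻¹` (`e` the frame of `k`, a box element, so `e⁻¹` is one), `γ₂(u_j) = γ₂(γ_H) · γ₂(k)⁻¹` (box), and `γ_H`
itself is hyperbolic at EVERY `w′ ∣ v` (`w′ = w` at a non-split `v`, ★ `PlacesOver.eq_of_smul_eq`; `|γ₂(γ_H)|_w = 1`, `|d′₁|_w < 1 < |d′₀|_w`) — so ★ p849690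
`exists_level_forall_finTau_eq_and_finWeylRatio_eq` (first conjunct, roles `γ_H⁰ :=` the running point, `γ_H := u_j`) gives `finTau u_j = finTau γ_H`.  No orientation or
hyperbolicity hypothesis on the representative `u_j` is consumed (it follows from that of the running point).

* §1 `finGammaTwo_mul` — `γ₂` is multiplicative (`U(Φ₁)` is a `1 × 1` matrix group).
* §2 `valued_hyperbolic_of_stratum` — the KIT-B stratum data put `|d′₁|_{w′} < |γ₂|_{w′} = 1 < |d′₀|_{w′}` at every `w′ ∣ v`.
* §3 **`exists_level_forall_finTau_eq_of_eq_mul`** — core: `γ_H = a · k`, `k` diagonal-framed in the level-`n` box ⇒ `finTau γ_H = finTau a` (level `n` from ★ p849690).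
* §4 **`exists_level_forall_finTau_eq_of_mem_smul`** (per representative) and **`exists_level_hτ_of_smul_cosets`** (KIT-B's `hτ` binder VERBATIM, `C j := u j • ↑S′`,
  `τ j := finTau L v ((u j).1, (u j).2) μ`) — the brick.
* §5 `boxXH_mem_nhds_one` — the box hypothesis on `S′` is a NEIGHBOURHOOD condition: `{k ∈ T_H × U(Φ₁)_v | torus coordinates in the level-n box} ∈ 𝓝 1` (★ LEVEL-PICK
  «BOX-OPEN» pulled back along the continuous coordinates), so ★ T-BASIS `exists_preimage_K_subset_of_mem_nhds` ∕ ★ LEVEL-PICK (LP2) pick `S′` inside it.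

## References
* [Rogawski1990] J. D. Rogawski, *Automorphic Representations of Unitary Groups in Three Variables*, Ann. of Math. Stud. 123 (1990): §4.9 p. 55 (definition of `τ`);
  Prop. 8.1.3 (proof) p. 116; §12.7 Lemma 12.7.3 (proof) p. 195.
* [TateThesis1967] J. Tate, *Fourier analysis in number fields and Hecke's zeta-functions*, in Cassels–Fröhlich (1967), §2.3 (conductor: a continuous quasi-character is
  trivial on some `1 + 𝔭ⁿ`).
-/

set_option autoImplicit false
-- the mandated namespace has the single-problem summit's repeated segment (`HodgeConjecture.HodgeConjecture`)
set_option linter.dupNamespace false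

noncomputable section

open Matrix NumberField IsDedekindDomain
open scoped MatrixGroups Pointwise
open Literature.NumberTheory.Rogawski1990 Literature.NumberTheory.Automorphic Literature.NumberTheory.Automorphic.UnitaryGroup
open Literature.NumberTheory.GaloisRepresentations

namespace Summit.HodgeConjecture.HodgeConjecture.Cruxes.H413.F0P3cStCharTSHtauOnCoset

variable (L : Type) [Field L] [NumberField L] [IsCMField L] (v : HeightOneSpectrum (𝓞 ↥(maximalRealSubfield L)))

/-! ## §1 `γ₂` is multiplicative -/

/-- **`γ₂(a·b) = γ₂(a)·γ₂(b)`** — the `U(Φ₁)`-coordinate is a `1 × 1` matrix entry. [cite: Rogawski1990, §4.9 p. 55] -/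
theorem finGammaTwo_mul
    (a b : (cmDatum L 2 (Matrix.of fun i j : Fin 2 => if i.val + j.val + 1 = 2 then (1 : L) else 0)).Local v ×
      (cmDatum L 1 (Matrix.of fun i j : Fin 1 => if i.val + j.val + 1 = 1 then (1 : L) else 0)).Local v) :
    finGammaTwo L v (a * b) = finGammaTwo L v a * finGammaTwo L v b := by
  have h : ((a * b).2.val.val : Matrix (Fin 1) (Fin 1) (LocalRing L v)) = a.2.val.val * b.2.val.val := rfl
  unfold finGammaTwo
  rw [h, Matrix.mul_apply, Fin.sum_univ_one]

/-! ## §2 The stratum data make the running point hyperbolic at every place above `v` -/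

variable (w : PlacesOver L v) (hw : IsCMField.complexConj L • w.1 = w.1)

include hw in
/-- **Hyperbolic at every `w′ ∣ v`.**  For `γ_H ∈ H_v` with `U(Φ₂)`-part `diag(d′₀, d′₁)`, `|d′₁|_w < |d′₀|_w` and `σ_w(d′₀,w)·d′₁,w = 1` (the KIT-B ∕ `hlevi` stratum data at the
non-split place `w`): at every `w′ ∣ v` (there is only `w′ = w`, ★ `PlacesOver.eq_of_smul_eq`) `|γ₂(γ_H)|_{w′} < |d′₀|_{w′}` and `|d′₁|_{w′} < |γ₂(γ_H)|_{w′}` (`|γ₂|_w = 1` ★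
`valued_finGammaTwo_apply_eq_one`; `|d′₀|_w·|d′₁|_w = 1` as `|σ_w x|_w = |x|_w`). [cite: Rogawski1990, §4.9 p. 55–56] -/
theorem valued_hyperbolic_of_stratum
    (γH : (cmDatum L 2 (Matrix.of fun i j : Fin 2 => if i.val + j.val + 1 = 2 then (1 : L) else 0)).Local v ×
      (cmDatum L 1 (Matrix.of fun i j : Fin 1 => if i.val + j.val + 1 = 1 then (1 : L) else 0)).Local v)
    (d' : Fin 2 → (LocalRing L v)ˣ)
    (hlt : Valued.v (((d' 1 : (LocalRing L v)ˣ) : LocalRing L v) w) < Valued.v (((d' 0 : (LocalRing L v)ˣ) : LocalRing L v) w))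
    (h01 : galAdicCompletionMap (L := L) (IsCMField.complexConj L) hw (((d' 0 : (LocalRing L v)ˣ) : LocalRing L v) w) * ((d' 1 : (LocalRing L v)ˣ) : LocalRing L v) w = 1)
    (w' : PlacesOver L v) :
    Valued.v (finGammaTwo L v γH w') < Valued.v (((d' 0 : (LocalRing L v)ˣ) : LocalRing L v) w') ∧
      Valued.v (((d' 1 : (LocalRing L v)ˣ) : LocalRing L v) w') < Valued.v (finGammaTwo L v γH w') := by
  obtain rfl : w' = w := PlacesOver.eq_of_smul_eq (IsCMField.complexConj L) (IsCMField.complexConj_ne_one L) w hw w'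
  have h1 : Valued.v (((d' 0 : (LocalRing L v)ˣ) : LocalRing L v) w') * Valued.v (((d' 1 : (LocalRing L v)ˣ) : LocalRing L v) w') = 1 := by
    rw [← valued_galAdicCompletionMap (L := L) (IsCMField.complexConj L) hw (((d' 0 : (LocalRing L v)ˣ) : LocalRing L v) w'), ← map_mul, h01, map_one]
  have h := F0P3cStCharTSOnStratumG.lt_one_lt_of_mul_eq_one_of_lt Valued.v h1 hlt
  rw [valued_finGammaTwo_apply_eq_one L v γH w' hw]
  exact ⟨h.2, h.1⟩

/-! ## §3 Core: `τ_v` does not see a box factor -/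

include hw in
/-- **CORE.**  There is a level `n` (that of ★ p849690 ∕ ★ MU-TRIV, `n ≥ cond μ_v`) such that: whenever `γ_H = a · k` in `H_v = U(Φ₂)_v × U(Φ₁)_v` with `γ_H` on the KIT-B stratum
(`U(Φ₂)`-part `diag(d′)`, `|d′₁|_w < |d′₀|_w`, `σ_w(d′₀,w)·d′₁,w = 1`) and `k` diagonal-framed (`k.1 = diag(e)`) with `e_i` and `γ₂(k)` in the level-`n` box at every `w′ ∣ v`, then
`finTau L v γ_H μ = finTau L v a μ`.  (★ p849690 first conjunct with `γ_H⁰ :=` the running point, frame of `a` = `d′·e⁻¹`, box factors `e⁻¹`, `γ₂(k)⁻¹`.)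
[cite: Rogawski1990, §4.9 p. 55; Prop. 8.1.3 (proof) p. 116] [cite: TateThesis1967, §2.3] -/
theorem exists_level_forall_finTau_eq_of_eq_mul (μ : HeckeCharacter L) :
    ∃ n : ℕ, ∀ (γH a k : (cmDatum L 2 (Matrix.of fun i j : Fin 2 => if i.val + j.val + 1 = 2 then (1 : L) else 0)).Local v ×
        (cmDatum L 1 (Matrix.of fun i j : Fin 1 => if i.val + j.val + 1 = 1 then (1 : L) else 0)).Local v),
      γH = a * k →
      ∀ (d' : Fin 2 → (LocalRing L v)ˣ), glDiagonal 2 (LocalRing L v) d' = ((γH.1).val : GL (Fin 2) (LocalRing L v)) →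
      ∀ (e : Fin 2 → (LocalRing L v)ˣ), glDiagonal 2 (LocalRing L v) e = ((k.1).val : GL (Fin 2) (LocalRing L v)) →
      (∀ i, ∀ w' : PlacesOver L v, Valued.v (((e i : (LocalRing L v)ˣ) : LocalRing L v) w' - 1) < WithZero.exp (-((n + 1 : ℕ) : ℤ))) →
      (∀ w' : PlacesOver L v, Valued.v (finGammaTwo L v k w' - 1) < WithZero.exp (-((n + 1 : ℕ) : ℤ))) →
      Valued.v (((d' 1 : (LocalRing L v)ˣ) : LocalRing L v) w) < Valued.v (((d' 0 : (LocalRing L v)ˣ) : LocalRing L v) w) →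
      galAdicCompletionMap (L := L) (IsCMField.complexConj L) hw (((d' 0 : (LocalRing L v)ˣ) : LocalRing L v) w) * ((d' 1 : (LocalRing L v)ˣ) : LocalRing L v) w = 1 →
      finTau L v γH μ = finTau L v a μ := by
  obtain ⟨n, hn⟩ := F0P3cStCharTSDeltaCosetConst.exists_level_forall_finTau_eq_and_finWeylRatio_eq L v μ
  refine ⟨n, fun γH a k hγ d' hd' e he hebox hkbox hlt h01 => ?_⟩
  have hr := F0P3cStCharTSDeltaCosetConst.exp_neg_succ_le_one n
  -- the frame of `a.1` is `d' * e⁻¹`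
  have ha1 : a.1 = γH.1 * (k.1)⁻¹ := by rw [hγ, Prod.fst_mul, mul_inv_cancel_right]
  have hframe : glDiagonal 2 (LocalRing L v) (d' * e⁻¹) = ((a.1).val : GL (Fin 2) (LocalRing L v)) := by
    rw [map_mul, map_inv, hd', he, ha1]
    rfl
  have he' : ∀ i, (((d' * e⁻¹) i : (LocalRing L v)ˣ) : LocalRing L v) = ((d' i : (LocalRing L v)ˣ) : LocalRing L v) * (((e i)⁻¹ : (LocalRing L v)ˣ) : LocalRing L v) := by
    intro i
    rw [Pi.mul_apply, Pi.inv_apply, Units.val_mul]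
  -- `γ₂(a) = γ₂(γ_H) · γ₂(k)⁻¹`
  have hku := isUnit_finGammaTwo L v k
  have hu : finGammaTwo L v a = finGammaTwo L v γH * ((hku.unit⁻¹ : (LocalRing L v)ˣ) : LocalRing L v) := by
    rw [hγ, finGammaTwo_mul, mul_assoc, IsUnit.mul_val_inv, mul_one]
  -- the box factors `e⁻¹`, `γ₂(k)⁻¹`
  have hebox' : ∀ i, ∀ w' : PlacesOver L v,
      Valued.v ((((e i)⁻¹ : (LocalRing L v)ˣ) : LocalRing L v) w' - 1) < WithZero.exp (-((n + 1 : ℕ) : ℤ)) := by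
    intro i w'
    refine F0P3cStCharTSDeltaCosetConst.map_sub_one_lt_of_mul_eq_one _ hr ?_ (hebox i w')
    rw [← Pi.mul_apply, Units.mul_inv, Pi.one_apply]
  have hkubox : ∀ w' : PlacesOver L v,
      Valued.v (((hku.unit⁻¹ : (LocalRing L v)ˣ) : LocalRing L v) w' - 1) < WithZero.exp (-((n + 1 : ℕ) : ℤ)) := by
    intro w'
    refine F0P3cStCharTSDeltaCosetConst.map_sub_one_lt_of_mul_eq_one _ hr ?_ (hkbox w')
    rw [← Pi.mul_apply, IsUnit.mul_val_inv, Pi.one_apply]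
  -- hyperbolic at the running point, every `w′`
  have hv := valued_hyperbolic_of_stratum L v w hw γH d' hlt h01
  exact (hn a γH d' (d' * e⁻¹) (fun i => (((e i)⁻¹ : (LocalRing L v)ˣ) : LocalRing L v)) _ hd' hframe hebox' hkubox he' hu
    (fun w' => (hv w').1) (fun w' => (hv w').2)).1.symm

/-! ## §4 The brick: `τ_v` is constant on each coset `u_j · S′` -/

include hw in
/-- **«HTAU-ON-COSET», per representative.**  There is a level `n` such that for every subgroup `S′ ≤ T_H × U(Φ₁)_v` whose torus coordinates lie in the level-`n` box (`|(k.1)_{ii,w′} −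
1|_{w′} < q_{w′}^{−(n+1)}` for `i = 0, 1` and `|γ₂(k)_{w′} − 1|_{w′} < q_{w′}^{−(n+1)}` for all `k ∈ S′`, `w′ ∣ v`), every representative `u ∈ T_H × U(Φ₁)_v`, and every `γ_H` on the
KIT-B stratum with torus point `t_H` (`↑t_H = γ_H.1`): `(t_H, γ_H.2) ∈ u · S′ ⇒ finTau L v γ_H μ = finTau L v u μ`.
[cite: Rogawski1990, §4.9 p. 55; Prop. 8.1.3 (proof) p. 116; §12.7 Lemma 12.7.3 (proof) p. 195] [cite: TateThesis1967, §2.3] -/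
theorem exists_level_forall_finTau_eq_of_mem_smul (μ : HeckeCharacter L) :
    ∃ n : ℕ, ∀ (S' : Subgroup (↥(cmBorelTriple L 2 v).M × (cmDatum L 1 (Matrix.of fun i j : Fin 1 => if i.val + j.val + 1 = 1 then (1 : L) else 0)).Local v)),
      (∀ k ∈ S', (∀ i : Fin 2, ∀ w' : PlacesOver L v,
          Valued.v (((torusEntry (conjLocal L (IsCMField.complexConj L) v) (cmLocalForm L 2 v) i k.1 : (LocalRing L v)ˣ) : LocalRing L v) w' - 1) <
            WithZero.exp (-((n + 1 : ℕ) : ℤ))) ∧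
        (∀ w' : PlacesOver L v,
          Valued.v (finGammaTwo L v ((k.1 : ↥(unitaryGroupOfForm (conjLocal L (IsCMField.complexConj L) v) (cmLocalForm L 2 v))), k.2) w' - 1) <
            WithZero.exp (-((n + 1 : ℕ) : ℤ)))) →
      ∀ (u : ↥(cmBorelTriple L 2 v).M × (cmDatum L 1 (Matrix.of fun i j : Fin 1 => if i.val + j.val + 1 = 1 then (1 : L) else 0)).Local v)
        (γH : ((cmDatum L 2 (Matrix.of fun i j : Fin 2 => if i.val + j.val + 1 = 2 then (1 : L) else 0)).Local v ×
          (cmDatum L 1 (Matrix.of fun i j : Fin 1 => if i.val + j.val + 1 = 1 then (1 : L) else 0)).Local v))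
        (d' : Fin 2 → (LocalRing L v)ˣ), glDiagonal 2 (LocalRing L v) d' = ((γH.1).val : GL (Fin 2) (LocalRing L v)) →
        Valued.v (((d' 1 : (LocalRing L v)ˣ) : LocalRing L v) w) < Valued.v (((d' 0 : (LocalRing L v)ˣ) : LocalRing L v) w) →
        galAdicCompletionMap (L := L) (IsCMField.complexConj L) hw (((d' 0 : (LocalRing L v)ˣ) : LocalRing L v) w) * ((d' 1 : (LocalRing L v)ˣ) : LocalRing L v) w = 1 →
        ∀ (tH : ↥(cmBorelTriple L 2 v).M), (tH : ↥(unitaryGroupOfForm (conjLocal L (IsCMField.complexConj L) v) (cmLocalForm L 2 v))) = γH.1 →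
        (tH, γH.2) ∈ u • (S' : Set (↥(cmBorelTriple L 2 v).M × (cmDatum L 1 (Matrix.of fun i j : Fin 1 => if i.val + j.val + 1 = 1 then (1 : L) else 0)).Local v)) →
        finTau L v γH μ =
          finTau L v ((u.1 : ↥(unitaryGroupOfForm (conjLocal L (IsCMField.complexConj L) v) (cmLocalForm L 2 v))), u.2) μ := by
  obtain ⟨n, hn⟩ := exists_level_forall_finTau_eq_of_eq_mul L v w hw μ
  refine ⟨n, fun S' hS' u γH d' hd' hlt h01 tH htH hx => ?_⟩
  obtain ⟨k, hkS, hk⟩ := Set.mem_smul_set.1 hx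
  rw [smul_eq_mul] at hk
  -- hk : u * k = (tH, γH.2)
  have hk1 : u.1 * k.1 = tH := by rw [← Prod.fst_mul, hk]
  have hk2 : u.2 * k.2 = γH.2 := by rw [← Prod.snd_mul, hk]
  have hγ : γH = ((u.1 : ↥(unitaryGroupOfForm (conjLocal L (IsCMField.complexConj L) v) (cmLocalForm L 2 v))), u.2) *
      ((k.1 : ↥(unitaryGroupOfForm (conjLocal L (IsCMField.complexConj L) v) (cmLocalForm L 2 v))), k.2) := by
    refine Prod.ext ?_ ?_
    · rw [Prod.fst_mul, ← Subgroup.coe_mul, hk1, htH]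
    · rw [Prod.snd_mul, hk2]
  -- the frame of `k.1` and its box property
  obtain ⟨e, he⟩ := (mem_torusU_iff _).1 k.1.2
  obtain ⟨hkbox₁, hkbox₂⟩ := hS' k hkS
  have hebox : ∀ i, ∀ w' : PlacesOver L v, Valued.v (((e i : (LocalRing L v)ˣ) : LocalRing L v) w' - 1) < WithZero.exp (-((n + 1 : ℕ) : ℤ)) := by
    intro i w'
    rw [← torusEntry_eq_of_glDiagonal_eq _ _ i k.1 e he]
    exact hkbox₁ i w'
  exact hn γH _ _ hγ d' hd' e he hebox hkbox₂ hlt h01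

include hw in
/-- **«HTAU-ON-COSET★» — KIT-B's `hτ` binder VERBATIM.**  There is a level `n` (`≥ cond μ_v`; deeper levels inherit the box hypothesis, ★ LEVEL-PICK `levelBox_antitone`) such
that for every level subgroup `S′ ≤ T_H × U(Φ₁)_v` with torus coordinates in the level-`n` box, every index set `s` and representatives `u_j`, the clause `hτ` of ★
`F0P3cStCharTSHleviCosets.hc_of_cosetSum` ∕ `hc_of_cosets` holds with `C j := u_j • ↑S′` and `τ j := finTau L v u_j μ`: along the hyperbolic `G`-regular diagonal-Levi stratum,
`(t_H, γ_H.2) ∈ C_j ⇒ finTau L v γ_H μ = τ_j`. [cite: Rogawski1990, §4.9 p. 55; Prop. 8.1.3 (proof) p. 116; §12.7 Lemma 12.7.3 (proof) p. 195] [cite: TateThesis1967, §2.3] -/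
theorem exists_level_hτ_of_smul_cosets (μ : HeckeCharacter L) :
    ∃ n : ℕ, ∀ (S' : Subgroup (↥(cmBorelTriple L 2 v).M × (cmDatum L 1 (Matrix.of fun i j : Fin 1 => if i.val + j.val + 1 = 1 then (1 : L) else 0)).Local v)),
      (∀ k ∈ S', (∀ i : Fin 2, ∀ w' : PlacesOver L v,
          Valued.v (((torusEntry (conjLocal L (IsCMField.complexConj L) v) (cmLocalForm L 2 v) i k.1 : (LocalRing L v)ˣ) : LocalRing L v) w' - 1) <
            WithZero.exp (-((n + 1 : ℕ) : ℤ))) ∧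
        (∀ w' : PlacesOver L v,
          Valued.v (finGammaTwo L v ((k.1 : ↥(unitaryGroupOfForm (conjLocal L (IsCMField.complexConj L) v) (cmLocalForm L 2 v))), k.2) w' - 1) <
            WithZero.exp (-((n + 1 : ℕ) : ℤ)))) →
      ∀ {ι : Type*} (s : Finset ι)
        (u : ι → ↥(cmBorelTriple L 2 v).M × (cmDatum L 1 (Matrix.of fun i j : Fin 1 => if i.val + j.val + 1 = 1 then (1 : L) else 0)).Local v),
      ∀ (γH : ((cmDatum L 2 (Matrix.of fun i j : Fin 2 => if i.val + j.val + 1 = 2 then (1 : L) else 0)).Local v ×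
          (cmDatum L 1 (Matrix.of fun i j : Fin 1 => if i.val + j.val + 1 = 1 then (1 : L) else 0)).Local v))
        (d' : Fin 2 → (LocalRing L v)ˣ), glDiagonal 2 (LocalRing L v) d' = ((γH.1).val : GL (Fin 2) (LocalRing L v)) → IsLocalGRegular L v γH →
        Valued.v (((d' 1 : (LocalRing L v)ˣ) : LocalRing L v) w) < Valued.v (((d' 0 : (LocalRing L v)ˣ) : LocalRing L v) w) →
        galAdicCompletionMap (L := L) (IsCMField.complexConj L) hw (((d' 0 : (LocalRing L v)ˣ) : LocalRing L v) w) * ((d' 1 : (LocalRing L v)ˣ) : LocalRing L v) w = 1 →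
        ∀ (tH : ↥(cmBorelTriple L 2 v).M), (tH : ↥(unitaryGroupOfForm (conjLocal L (IsCMField.complexConj L) v) (cmLocalForm L 2 v))) = γH.1 →
        ∀ j ∈ s, (tH, γH.2) ∈ u j • (S' : Set (↥(cmBorelTriple L 2 v).M × (cmDatum L 1 (Matrix.of fun i j : Fin 1 => if i.val + j.val + 1 = 1 then (1 : L) else 0)).Local v)) →
          finTau L v γH μ =
            finTau L v (((u j).1 : ↥(unitaryGroupOfForm (conjLocal L (IsCMField.complexConj L) v) (cmLocalForm L 2 v))), (u j).2) μ := by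
  obtain ⟨n, hn⟩ := exists_level_forall_finTau_eq_of_mem_smul L v w hw μ
  refine ⟨n, ?_⟩
  intro S' hS' _ι _s u γH d' hd' _hreg hlt h01 tH htH j _hj hx
  exact hn S' hS' (u j) γH d' hd' hlt h01 tH htH hx

/-! ## §5 The box hypothesis is a neighbourhood condition -/

/-- **The level-`n` box of `T_H × U(Φ₁)_v` is a neighbourhood of `1`**: the set of `k` whose torus coordinates `(k.1)_{ii}` (`i = 0, 1`) and `γ₂(k)` lie in the principal congruence
box `{x | ∀ w′ ∣ v, |x_{w′} − 1|_{w′} < q_{w′}^{−(n+1)}}` (★ LEVEL-PICK `isOpen_levelBox`, `one_mem_levelBox`, pulled back along the continuous coordinate maps) — the shape in which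
★ T-BASIS `exists_preimage_K_subset_of_mem_nhds` ∕ ★ LEVEL-PICK (LP2) deliver a level subgroup `S′` satisfying the box hypothesis of §4.
[cite: TateThesis1967, §2.3] [cite: Rogawski1990, Prop. 8.1.3 (proof) p. 116] -/
theorem boxXH_mem_nhds_one (n : ℕ) :
    {k : ↥(cmBorelTriple L 2 v).M × (cmDatum L 1 (Matrix.of fun i j : Fin 1 => if i.val + j.val + 1 = 1 then (1 : L) else 0)).Local v |
      (∀ i : Fin 2, ∀ w' : PlacesOver L v,
          Valued.v (((torusEntry (conjLocal L (IsCMField.complexConj L) v) (cmLocalForm L 2 v) i k.1 : (LocalRing L v)ˣ) : LocalRing L v) w' - 1) <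
            WithZero.exp (-((n + 1 : ℕ) : ℤ))) ∧
        (∀ w' : PlacesOver L v,
          Valued.v (finGammaTwo L v ((k.1 : ↥(unitaryGroupOfForm (conjLocal L (IsCMField.complexConj L) v) (cmLocalForm L 2 v))), k.2) w' - 1) <
            WithZero.exp (-((n + 1 : ℕ) : ℤ)))} ∈
      nhds (1 : ↥(cmBorelTriple L 2 v).M × (cmDatum L 1 (Matrix.of fun i j : Fin 1 => if i.val + j.val + 1 = 1 then (1 : L) else 0)).Local v) := by
  have hB := F0P3cStCharTSLevelPick.isOpen_levelBox L v n
  have h1B := F0P3cStCharTSLevelPick.one_mem_levelBox L v n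
  -- the torus coordinates
  have h1 : ∀ i : Fin 2,
      {k : ↥(cmBorelTriple L 2 v).M × (cmDatum L 1 (Matrix.of fun i j : Fin 1 => if i.val + j.val + 1 = 1 then (1 : L) else 0)).Local v |
        ∀ w' : PlacesOver L v,
          Valued.v (((torusEntry (conjLocal L (IsCMField.complexConj L) v) (cmLocalForm L 2 v) i k.1 : (LocalRing L v)ˣ) : LocalRing L v) w' - 1) <
            WithZero.exp (-((n + 1 : ℕ) : ℤ))} ∈
      nhds (1 : ↥(cmBorelTriple L 2 v).M × (cmDatum L 1 (Matrix.of fun i j : Fin 1 => if i.val + j.val + 1 = 1 then (1 : L) else 0)).Local v) := by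
    intro i
    have hc : Continuous fun k : ↥(cmBorelTriple L 2 v).M × (cmDatum L 1 (Matrix.of fun i j : Fin 1 => if i.val + j.val + 1 = 1 then (1 : L) else 0)).Local v =>
        ((torusEntry (conjLocal L (IsCMField.complexConj L) v) (cmLocalForm L 2 v) i k.1 : (LocalRing L v)ˣ) : LocalRing L v) := by
      simp only [coe_torusEntry]
      exact (((Units.continuous_val.comp continuous_subtype_val).comp continuous_subtype_val).matrix_elem i i).comp continuous_fst
    refine (hB.preimage hc).mem_nhds ?_
    show (fun k : ↥(cmBorelTriple L 2 v).M × (cmDatum L 1 (Matrix.of fun i j : Fin 1 => if i.val + j.val + 1 = 1 then (1 : L) else 0)).Local v =>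
        ((torusEntry (conjLocal L (IsCMField.complexConj L) v) (cmLocalForm L 2 v) i k.1 : (LocalRing L v)ˣ) : LocalRing L v)) 1 ∈
      {x : LocalRing L v | ∀ w : PlacesOver L v, Valued.v (x w - 1) < WithZero.exp (-((n + 1 : ℕ) : ℤ))}
    simp only [Prod.fst_one, map_one, Units.val_one]
    exact h1B
  -- the `U(Φ₁)` coordinate
  have h2 :
      {k : ↥(cmBorelTriple L 2 v).M × (cmDatum L 1 (Matrix.of fun i j : Fin 1 => if i.val + j.val + 1 = 1 then (1 : L) else 0)).Local v |
        ∀ w' : PlacesOver L v,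
          Valued.v (finGammaTwo L v ((k.1 : ↥(unitaryGroupOfForm (conjLocal L (IsCMField.complexConj L) v) (cmLocalForm L 2 v))), k.2) w' - 1) <
            WithZero.exp (-((n + 1 : ℕ) : ℤ))} ∈
      nhds (1 : ↥(cmBorelTriple L 2 v).M × (cmDatum L 1 (Matrix.of fun i j : Fin 1 => if i.val + j.val + 1 = 1 then (1 : L) else 0)).Local v) := by
    have hc : Continuous fun k : ↥(cmBorelTriple L 2 v).M × (cmDatum L 1 (Matrix.of fun i j : Fin 1 => if i.val + j.val + 1 = 1 then (1 : L) else 0)).Local v =>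
        finGammaTwo L v ((k.1 : ↥(unitaryGroupOfForm (conjLocal L (IsCMField.complexConj L) v) (cmLocalForm L 2 v))), k.2) := by
      have h1 : Continuous fun k : ↥(cmBorelTriple L 2 v).M × (cmDatum L 1 (Matrix.of fun i j : Fin 1 => if i.val + j.val + 1 = 1 then (1 : L) else 0)).Local v =>
          (k.2.val.val : Matrix (Fin 1) (Fin 1) (LocalRing L v)) :=
        Units.continuous_val.comp (continuous_subtype_val.comp continuous_snd)
      unfold finGammaTwo
      exact (continuous_apply 0).comp ((continuous_apply 0).comp h1)
    refine (hB.preimage hc).mem_nhds ?_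
    show finGammaTwo L v (((1 : ↥(cmBorelTriple L 2 v).M × (cmDatum L 1 (Matrix.of fun i j : Fin 1 => if i.val + j.val + 1 = 1 then (1 : L) else 0)).Local v).1 :
        ↥(unitaryGroupOfForm (conjLocal L (IsCMField.complexConj L) v) (cmLocalForm L 2 v))), (1 : ↥(cmBorelTriple L 2 v).M × (cmDatum L 1 (Matrix.of fun i j : Fin 1 => if i.val + j.val + 1 = 1 then (1 : L) else 0)).Local v).2) ∈
      {x : LocalRing L v | ∀ w : PlacesOver L v, Valued.v (x w - 1) < WithZero.exp (-((n + 1 : ℕ) : ℤ))}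
    have h : finGammaTwo L v (((1 : ↥(cmBorelTriple L 2 v).M × (cmDatum L 1 (Matrix.of fun i j : Fin 1 => if i.val + j.val + 1 = 1 then (1 : L) else 0)).Local v).1 :
        ↥(unitaryGroupOfForm (conjLocal L (IsCMField.complexConj L) v) (cmLocalForm L 2 v))), (1 : ↥(cmBorelTriple L 2 v).M × (cmDatum L 1 (Matrix.of fun i j : Fin 1 => if i.val + j.val + 1 = 1 then (1 : L) else 0)).Local v).2) = 1 := by
      unfold finGammaTwo
      rw [Prod.snd_one]
      exact Matrix.one_apply_eq 0
    rw [h]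
    exact h1B
  exact Filter.mem_of_superset (Filter.inter_mem (Filter.iInter_mem.2 h1) h2) fun k hk => ⟨fun i => Set.mem_iInter.1 hk.1 i, hk.2⟩

end Summit.HodgeConjecture.HodgeConjecture.Cruxes.H413.F0P3cStCharTSHtauOnCoset

end
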